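import Literature.MathematicalPhysics.QuantumFieldTheory.Balaban1983to89.B8Prop5NestedServerPerBody

/-!
# `Balaban1983to89.B8Prop5NestedServerPerL` — [Balaban1985RegularSpaces] Prop. 5 (1.107)–(1.108) p. 94, EXISTENCE, pub-ymgap T5's guarded sockets
# `SP5base` ∕ `SP5` at NESTED `P`-PERIODIC MEMBERS (p. 77 «Ω_j ⊂ T_η»), instance (i) `LanF := IsLandau138W` — EDITION «L»: `B8Prop5NestedServerPer`
# (lit-balaban r05, p659564) VERBATIM with the [4]-letter hypothesis `hLet` RESTRICTED TO THE SMALL-FIELD CLASS `α₀ ≤ c_L`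
# ([Balaban1985BackgroundPropagators] Thm 3.1 p. 397 supplies the letters for `0 < α₀ ≤ α₁` only) — the instance-(i) symmetry twin of pub-ymgap
# dag-n05-c's `B8Prop5NestedServerSrcPerL` (cure (L1) of referee ref-A g36's WATCH-HLET-THRESHOLD; dag-lead g19 IR-N05-HLET-L1; dag-n05-d g15's ASK
# «+ `B8Prop5NestedServerPer` for symmetry»)

statement-level skeleton of published theorems with citation tags; proofs where landed; nothing here is a claim about the Yang–Mills mass gap

T. Bałaban, *Spaces of regular gauge field configurations on a lattice and gauge fixing conditions*, Commun. Math. Phys. **99** (1985) 75–102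
`[Balaban1985RegularSpaces]` ("B8"; PDF page = printed page − 74): Prop. 5 (1.107)–(1.109) p. 94, Thm 4 p. 88 + pp. 88–89 + 94–95, (1.29) p. 81, (1.33)–(1.38)
p. 82, (1.66) p. 88, (1.68)–(1.69) p. 88, p. 77 («Ω_j ⊂ T_η»).  T. Bałaban, *Propagators for lattice gauge theories in a background field*, Commun. Math. Phys.
**99** (1985) 389–434 `[Balaban1985BackgroundPropagators]` ("[4]"; held `paper:balaban1985-cmp99-background-propagators`, p0009 = p. 397): Thm 3.1 p. 397
(«There exist constants α₁ > 0, … such that for U ∈ 𝔄_k(Ω, α₀), 0 < α₀ ≦ α₁ …»), Thm 3.3 p. 399 («Under the assumptions of Theorem 3.1»), (3.19) p. 393.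
STATUS: published, refereed.

CITATION HEADER (lean-in-tree rule).  Cell `lit-balaban` (mega-formalisation of Bałaban's CMP series; HUMAN RULING 2026-08-20), seat `lit-balaban-p21`
(gen 44), author-lineage of the instance-(ii) server `B8Prop5NestedServerSrcPer` (p667408); typed on the pub-ymgap bus agreement of 2026-08-28 (ref-A g36
READ-27 ⚠ WATCH-HLET-THRESHOLD on the N05 slot-of-record head p669550; dag-n05-d g15 «cure = (L1) the servers with `hLet` thresholded at `c_L` → (L2) → (L3)»;
dag-n05-c g18 types the instance-(ii) twin `B8Prop5NestedServerSrcPerL`; THIS file is the instance-(i) twin with the SAME three-token edit and the same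
naming scheme).  `--supports stmt-QuantumFields-19200` (count-neutral).

WHY.  `B8Prop5NestedServerPer.sockP5Per_of_lettersAtPerNested ∕ sockP5basePer_of_lettersAtPerNested` (p659564) display the [4] letters `hLet` for EVERY
`α₀ > 0`; but `InAk` ((1.7): `|U(∂p) − 1| < α₀L^{−2j}`) is monotone in `α₀`, so for large `α₀` every unitary periodic background lies in the class, where
print ([4] Thm 3.1 p. 397) does NOT supply the letters with background-uniform constants — as a HYPOTHESIS the threshold-free family over-reaches print
(ref-A).  The servers invoke the letters ONLY at the socket's own `α₀`, where `α₀ < α₀ + α₁ ≤ c_P`; restricting `hLet` to `α₀ ≤ c_L` and asking `c_P ≤ c_L`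
is therefore PROOF-NEUTRAL, and it is the faithful display (the author's word of p21 g44 on the pub-ymgap bus, 2026-08-28T21:44Z).  A NEW module: p659564
is not touched (its importers `B8Prop5NestedServerSrcPer`, `B8Prop5ExistsZdLanPer` keep compiling unchanged).

WHAT THIS FILE PROVES (two theorems, no `def`; p659564's statements and proofs TOKEN FOR TOKEN except: `hLet` gains the antecedent `α₀ ≤ cL →`; a new
binder `(hPL : cP ≤ cL)` after the windows; the two letter invocations pass `(by linarith)` for `α₀ ≤ cL` from `0 < α₁`, `α₀ + α₁ ≤ cP ≤ cL`):
* ★★★ `sockP5PerL_of_lettersAtPerNested` — T5's `SP5` text (instance (i) `IsLandau138W`; `Adm`, `Φ`, `φ` arbitrary) from the per-member laws, the b9 socket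
  of Proposition 3's frame `SockB9P3` at `B₈`, the THRESHOLDED letters `hLet`, the windows `hwin`, `cP ≤ cL`.
* ★★★ `sockP5basePerL_of_lettersAtPerNested` — T5's `SP5base` text likewise (plus `2 ≤ 5dLB₈`, p. 89).
Engines (unchanged, BY NAME): r05's FILE 1 `B8Prop5NestedServerPerBody.sP5_body_of_join_per ∕ sP5base_body_of_join_per`.

HONEST SCOPE.  By-name re-assembly; 0 new estimates; Proposition 5 ∕ Sect. E ∕ [4] Thms 3.1, 3.3 ∕ [3] Prop. 10 NOT re-proved — the letters (now in
print's small-field regime), the b9 socket and the windows are HYPOTHESES; no joint-satisfiability claim; `≤` where print has `<` in (1.108) (T5's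
currency); `d, L ≥ 2`.  Count-neutral; a server does NOT discharge N05; `T_η` read as `P`-periodic data on `ηℤᵈ`; one finite `𝕋⁴` programme at fixed `ε`,
Bałaban as printed; the Yang–Mills mass gap (Clay) is NOT proved by any of this — nothing continuum ∕ ℝ⁴ ∕ OS.  No `sorry`, no `def`, no `instance`,
no `notation`.  RELATED, NOT DUPLICATED: `B8Prop5NestedServerPer` (the threshold-free original, kept for its importers), `B8Prop5NestedServerSrcPerL`
(pub-ymgap dag-n05-c, instance (ii)).  Searched 2026-08-28: `lean search 'PerL_of_lettersAtPerNested' --decl` = ∅.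
-/

noncomputable section

open NormedSpace
open scoped BigOperators

namespace Literature.MathematicalPhysics.QuantumFieldTheory.Balaban1983to89.B8Prop5NestedServerPerL

open B7Prop1Explicit B7Prop2Explicit B7Prop1Local B7Eq92Concrete
open B7Prop2Explicit (C0 c2')
open B7Prop3Flat (c3)
open B7Prop10General (C6 C4G)
open B7Prop9Flat (C5')
open B7Eq78Linearization (zdBlocking QprimeIter)
open B8Ineq130 (tlo thi)
open B8Ineq132 (covDerivFwd InAk)
open B8Eq119TwistedAxial (Restr129 InAx bgT)
open B8Eq184Proof (gaugeExp cfgExp)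
open B8Lemma1NonAbelian (mulCfg)
open B8Eq140Level (SideTouches)
open B8Eq138LandauZd (IsLandau138W covLap QT)
open B8Ineq125Concrete (C2p)
open B8Eq1117Concrete (XSpace)
open B8Prop5ContractionKLevel (Bd2 Mc Kc)
open B8LambdaSpaceKLevel (wt)
open B8LeafModelZd (ZdIdx)
open B8LeafModelZd3 (SockB9P3)
open B8Prop5NestedServerPerBody (sP5_body_of_join_per sP5base_body_of_join_per)
open QuantumLattice (blockSites)
open T4TermwiseTorus (IsPeriodic)

-- `Site` alone could resolve to the torus sites of `Setup.lean`; re-export the `ℤ^d` sites of `B7Prop1Explicit`.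
export B7Prop1Explicit (Site)

variable {d : ℕ}

section Sockets

variable {𝔸 : Type*} [CStarAlgebra 𝔸] [Nontrivial 𝔸]

/-- ★★★ EDITION «L» (letters thresholded at `c_L`, `cP ≤ cL`; `B8Prop5NestedServerPer.sockP5Per_of_lettersAtPerNested` (p659564) otherwise VERBATIM) of: **pub-ymgap T5's GUARDED SOCKET `SP5` :131–:149 (PROPOSITION 5, EXISTENCE AT LEVEL `m + 1`, PERIODIC ARGUMENTS, NESTED `P`-PERIODIC MEMBERS) —
THE BINDER TEXT VERBATIM at instance (i) `LanF a U₀ φ m W := IsLandau138W L m (ι a).η ((ι a).Ω 0) ((ι a).Λs m) U₀ W`** (`Adm`, `Φ`, `φ` arbitrary), over an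
index map `ι : J → ZdIdx d L` and a period map `p : J → ℕ`, FROM: the per-member laws (towers at every truncation, truncation relations, `Lʲ ∣ p a`,
`Λ_j^{(m)}` shift-invariant, `Ω_j` `(p a)`-periodic), the b9 socket of Proposition 3's frame at every `1 ≤ m < k`, ONE DISPLAYED SUPPLIER `hLet` of the [4]
letters at `((ι a), n, U₀)` for every periodic unitary `U₀ ∈ 𝔄_k({Ω_j}, α₀)` and every truncation `1 ≤ n ≤ k` (linear maps `G′, Δ↾Ω₀, Q′, Q′ᵀ𝔄, 𝔄, C, H′` with
(E1) ∕ (E2) ∕ (1.91) at periodic arguments, the readings, the `H′` ∕ `G′` ∕ remainder laws, (P) — the module docstring of FILE 1 lists them), and the JOIN's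
scalar windows `hwin` below the threshold `cP` (the shape of `B8Thm2TorusServerPer.sockP5Step_of_lettersAtPer`'s, remainder constant `B_R` as supplied).
PROOF: at each `(a, α₀, α₁, U₀, U′, m, datum)` read the letters at `n := m + 1` and the windows, and call FILE 1's `sP5_body_of_join_per`.
[cite: Balaban1985RegularSpaces, Prop. 5 (1.107)–(1.108) p.94, Thm 4 p.88, (1.68)–(1.69) p.88, (1.38) p.82, (1.29) p.81, p.77 («Ω_j ⊂ T_η»); Balaban1985BackgroundPropagators, Thm 3.1 p.397, Thm 3.3 p.399, (3.19) p.393] -/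
theorem sockP5PerL_of_lettersAtPerNested (hd2 : 2 ≤ d) {L : ℕ} (hL : 2 ≤ L)
    {β : ℝ} {len : Site d → ℝ} {B₀' B₈ cP B₀β cB9 B₀'H B₂' BG BR cL : ℝ}
    (hB₀' : 0 < B₀') (hB₈ : 0 < B₈) (hB₀'H : 0 < B₀'H) (hB₂' : 0 ≤ B₂') (hBG : 0 ≤ BG) (hBR : 0 ≤ BR)
    {J : Type*} (ι : J → ZdIdx d L) (p : J → ℕ) {Φ : Type*}
    (Adm : J → Φ → (Site d → Fin d → 𝔸ˣ) → ℝ → ℝ → Prop)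
    -- PER-MEMBER LAWS (displayed): towers «Bʲ(y) ⊂ Ω_j» at every truncation, the truncation relations of the families `Λs m` ∕ `Λs (m+1)`,
    -- the torus data `Lʲ ∣ P`, `Λ_j^{(m)}` shift-invariant, `Ω_j` `P`-periodic (print's «Ω_j ⊂ T_η», p. 77)
    (htw : ∀ a : J, ∀ m, m ≤ (ι a).k → ∀ j, j ≤ m → ∀ y ∈ (ι a).Λs m j, ∀ x, InBox (tlo L y j) (thi L y j) x → x ∈ (ι a).Ω j)
    (hlt : ∀ a : J, ∀ m, m < (ι a).k → ∀ j, j < m → (ι a).Λs m j = (ι a).Λs (m + 1) j)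
    (htop : ∀ a : J, ∀ m, m < (ι a).k → ∀ x, x ∈ (ι a).Λs m m ↔ x ∈ (ι a).Λs (m + 1) m ∨ ∃ y ∈ (ι a).Λs (m + 1) (m + 1), x ∈ blockSites L y)
    (hdiv : ∀ a : J, ∀ j, j ≤ (ι a).k → ((L : ℤ) ^ j ∣ (p a : ℤ)))
    (hΛ : ∀ a : J, ∀ m, m ≤ (ι a).k → ∀ j, j ≤ m → ∀ (y : Site d) (i : Fin d),
      y + ((p a : ℤ) / (L : ℤ) ^ j) • e i ∈ (ι a).Λs m j ↔ y ∈ (ι a).Λs m j)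
    (hΩp : ∀ a : J, ∀ j, j ≤ (ι a).k → IsPeriodic (p a) (fun x : Site d => x ∈ (ι a).Ω j))
    -- THE b9 SOCKET OF PROPOSITION 3's FRAME AT EVERY LEVEL `1 ≤ m < k` ([4] Thm 3.3; displayed)
    (SB9 : ∀ a : J, ∀ m, 1 ≤ m → m < (ι a).k → SockB9P3 (𝔸 := 𝔸) L B₈ B₀β cB9 β len (ι a).η m (ι a).Ω (ι a).Λs (ι a).Λb)
    -- THE [4] LETTERS AT NESTED `Ω_j` IN THE SMALL-FIELD CLASS `α₀ ≤ c_L` ([4] Thm 3.1 p. 397; displayed supplier; N06's periodic Green's-function line)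
    (hLet : ∀ a : J, ∀ α₀ : ℝ, 0 < α₀ → α₀ ≤ cL → ∀ U₀ : Site d → Fin d → 𝔸ˣ, (∀ x κ, U₀ x κ ∈ unitaryUnits 𝔸) → IsPeriodic (p a) U₀ →
      InAk L (ι a).k (ι a).η α₀ (ι a).Ω U₀ → ∀ n, 1 ≤ n → n ≤ (ι a).k →
      ∃ (g Δ : (Site d → 𝔸) →ₗ[ℂ] (Site d → 𝔸)) (q : (Site d → 𝔸) →ₗ[ℂ] (ℕ → Site d → 𝔸)) (qs : (ℕ → Site d → 𝔸) →ₗ[ℂ] (Site d → 𝔸))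
        (Aw c : (ℕ → Site d → 𝔸) →ₗ[ℂ] (ℕ → Site d → 𝔸)) (H' : XSpace d n 𝔸 →ₗ[ℂ] (Site d → 𝔸)),
        (∀ x, (∀ (z : Site d) (i : Fin d), x (z + (p a : ℤ) • e i) = x z) → ∀ y ∈ (ι a).Ω 0, (Δ (g x) + qs (Aw (q (g x)))) y = x y) ∧
        (∀ f, (∀ (z : Site d) (i : Fin d), f (z + (p a : ℤ) • e i) = f z) → q (g (g (qs (c (q f))))) = q f) ∧
        (∀ (f : Site d → 𝔸) (z : Site d) (i : Fin d), g f (z + (p a : ℤ) • e i) = g f z) ∧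
        (∀ f : Site d → 𝔸, (∀ (z : Site d) (i : Fin d), f (z + (p a : ℤ) • e i) = f z) →
      ∀ (z : Site d) (i : Fin d), qs (c (q f)) (z + (p a : ℤ) • e i) = qs (c (q f)) z) ∧
        (∀ (f : Site d → 𝔸), ∀ x ∈ (ι a).Ω 0, Δ f x = covLap (ι a).η U₀ (((ι a).Ω 0).indicator f) x) ∧
        (∀ (μ : ℕ → Site d → 𝔸), ∀ x ∈ (ι a).Ω 0, qs μ x = QT L n ((ι a).Λs n) U₀ μ x) ∧
        (∀ (f : Site d → 𝔸) (j : ℕ), j ≤ n → ∀ y ∈ (ι a).Λs n j, q f j y = QprimeIter (zdBlocking d L) (bgT L U₀) j f y) ∧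
        (∀ (X : XSpace d n 𝔸) (x : Site d), ‖H' X x‖ ≤ B₀'H * ‖X‖) ∧
        (∀ j, j ≤ n → ∀ (X : XSpace d n 𝔸), ∀ b ∈ {b : Site d × Fin d | SideTouches ((ι a).Ω j) b.1 b.2},
      wt L (ι a).η j * ‖covDerivFwd (ι a).η U₀ b.2 (H' X) b.1‖ ≤ B₀'H * ‖X‖) ∧
        (∀ X : XSpace d n 𝔸, Bd2 L (ι a).η n (ι a).Ω (covLap (ι a).η U₀ (H' X)) (B₂' * ‖X‖)) ∧
        (∀ (X : XSpace d n 𝔸) (x : Site d), x ∉ (ι a).Ω 0 → H' X x = 0) ∧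
        (∀ X Y : XSpace d n 𝔸, (∀ b, Y b = -star (X b)) → ∀ x, H' Y x = -star (H' X x)) ∧
        (∀ X : XSpace d n 𝔸, (∀ (b : Fin (n + 1) × Site d) (i : Fin d), X (b.1, b.2 + ((p a : ℤ) / (L : ℤ) ^ (b.1 : ℕ)) • e i) = X b) →
      ∀ (z : Site d) (i : Fin d), H' X (z + (p a : ℤ) • e i) = H' X z) ∧
        (∀ (Y : XSpace d n 𝔸), (∀ (b : Fin (n + 1) × Site d) (i : Fin d), Y (b.1, b.2 + ((p a : ℤ) / (L : ℤ) ^ (b.1 : ℕ)) • e i) = Y b) →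
      ∀ (j : ℕ) (hj : j ≤ n) (y : Site d), y ∈ (ι a).Λs n j →
      QprimeIter (zdBlocking d L) (bgT L U₀) j (H' Y) y = Y (⟨j, Nat.lt_succ_of_le hj⟩, y)) ∧
        (∀ (f : Site d → 𝔸) (r : ℝ), 0 ≤ r → Bd2 L (ι a).η n (ι a).Ω f r →
      (∀ x, ‖g f x‖ ≤ BG * r) ∧ ∀ j, j ≤ n → ∀ b ∈ {b : Site d × Fin d | SideTouches ((ι a).Ω j) b.1 b.2},
        wt L (ι a).η j * ‖covDerivFwd (ι a).η U₀ b.2 (g f) b.1‖ ≤ BG * r) ∧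
        (∀ (f : Site d → 𝔸) (x : Site d), x ∉ (ι a).Ω 0 → g f x = 0) ∧
        (∀ f : Site d → 𝔸, (∀ j, j ≤ n → ∀ x ∈ (ι a).Ω j, IsSelfAdjoint (f x)) → ∀ x, IsSelfAdjoint (g f x)) ∧
        (∀ (f : Site d → 𝔸) (r : ℝ), 0 ≤ r → Bd2 L (ι a).η n (ι a).Ω f r → Bd2 L (ι a).η n (ι a).Ω (f - g (qs (c (q (g f))))) (BR * r)) ∧
        (∀ f : Site d → 𝔸, (∀ j, j ≤ n → ∀ x ∈ (ι a).Ω j, IsSelfAdjoint (f x)) →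
      ∀ j, j ≤ n → ∀ x ∈ (ι a).Ω j, IsSelfAdjoint ((f - g (qs (c (q (g f))))) x)))
    -- THE JOIN's SCALAR WINDOWS BELOW `cP` (displayed; `c⋆ = 5dLB₈(α₀+α₁)`, `α₄ = 8B₀′(5dLB₈)(α₀+α₁)`, `c_B = c_A = L·c⋆`, `c_DA = 2dL²c⋆`)
    (hwin : ∀ α₀ α₁ : ℝ, 0 < α₀ → 0 < α₁ → α₀ + α₁ ≤ cP → ∀ cs α₄ cB cDA hE hE₂ lE lE₂ : ℝ,
      cs = 5 * (d : ℝ) * L * B₈ * (α₀ + α₁) → α₄ = 8 * B₀' * (5 * (d : ℝ) * L * B₈) * (α₀ + α₁) →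
      cB = L * cs → cDA = 2 * (d : ℝ) * (L : ℝ) ^ 2 * cs →
      hE = B₀'H * (C2p d * (40 * d * cB + α₄) * α₄) → hE₂ = B₂' * (C2p d * (40 * d * cB + α₄) * α₄) →
      lE = B₀'H * (4 * C2p d * (40 * d * cB + 2 * α₄)) → lE₂ = B₂' * (4 * C2p d * (40 * d * cB + 2 * α₄)) →
      36 * d * B₈ * cs ≤ 1 / 2 ∧
      8 * (131072 * ((d : ℝ) + 1) ^ 2) * Real.exp (4 * (800 * ((d : ℝ) + 1) ^ 2 * ((d : ℝ) + 4)) * α₀) ≤ 16 * (131072 * ((d : ℝ) + 1) ^ 2) ∧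
      2 * cs ^ 2 + 20 * d * α₀ * cs + 2 * (16 * (131072 * ((d : ℝ) + 1) ^ 2)) * cs ^ 2 ≤ α₀ + α₁ ∧
      (d : ℝ) * L * α₁ ≤ 1 / 8 ∧
      α₀ ≤ cB9 ∧ cs ≤ cB9 ∧
      C0 d * α₀ ≤ 1 / 3 ∧ 4 * α₀ ≤ c2' d L ∧
      Real.exp (4 * (800 * ((d : ℝ) + 1) ^ 2 * ((d : ℝ) + 4)) * α₀) * (1 + 8 * (131072 * ((d : ℝ) + 1) ^ 2) * cB) ≤ 2 ∧
      2 * cB ≤ c3 d L ∧ 2048 * (d : ℝ) * cB ≤ 1 ∧ 40 * d * cB ≤ 1 / 200 ∧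
      200 * C6 d * (2 * α₄) ≤ 1 ∧ 12000 * ((d : ℝ) + 1) * L * (2 * α₄) ≤ 1 ∧
      C4G d L * (α₀ + 40 * d * cB + 4 * (2 * α₄)) ≤ 1 ∧
      1024 * ((d : ℝ) + 1) * ((d : ℝ) + 4) * L ^ 2 * α₀ ≤ 1 ∧ 32 * ((d : ℝ) + 1) ^ 2 * C6 d * L ^ 2 * α₀ ≤ 1 ∧
      16 * d * C5' d * C6 d * (L : ℝ) ^ 2 * α₀ ≤ 1 ∧ 8 * d * C6 d * L * α₀ ≤ 1 ∧
      40 * d * cB + α₄ ≤ 1 / (4 * B₀'H * (2 * C2p d)) ∧ 2 * C6 d * (40 * d * cB + 4 * α₄) ≤ 1 / 8 ∧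
      cB ≤ 1 / 13 ∧ α₄ / 4 + hE ≤ 1 / 24 ∧ α₄ / 4 + hE ≤ 1 / 140 ∧ 10 * (α₄ / 4 + hE) * BR ≤ 1 / 2 ∧
      BG * Mc d BR (α₄ / 4 + hE) cB hE₂ cDA ≤ α₄ / 4 ∧
      BG * Kc d BR (α₄ / 4 + hE) cB hE₂ cDA lE₂ (1 + lE) (1 + lE) ≤ 1 / 2)
    -- EDITION «L»: the sockets' threshold lies below the letters' small-field threshold
    (hPL : cP ≤ cL) :
    ∀ a : J, ∀ α₀ α₁ : ℝ, 0 < α₀ → 0 < α₁ → α₀ + α₁ ≤ cP →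
      ∀ U₀ U' : Site d → Fin d → 𝔸ˣ, (∀ x κ, U₀ x κ ∈ unitaryUnits 𝔸) → (∀ x κ, U' x κ ∈ unitaryUnits 𝔸) →
      IsPeriodic (p a) U₀ → IsPeriodic (p a) U' → ∀ φ : Φ, Adm a φ U₀ α₀ α₁ →
      InAk L (ι a).k (ι a).η α₀ (ι a).Ω U₀ → InAk L (ι a).k (ι a).η α₀ (ι a).Ω (mulCfg U' U₀) → (∀ m, m ≤ (ι a).k → InAx L m ((ι a).Λs m) U₀ (mulCfg U' U₀)) →
      (∀ j, j ≤ (ι a).k → ∀ (z : Site d) (μ : Fin d),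
        ((∀ x, InBox (tlo L z j) (thi L z j) x → x ∈ (ι a).Ω j) ∨ (∀ x, InBox (tlo L (z + e μ) j) (thi L (z + e μ) j) x → x ∈ (ι a).Ω j)) →
        ‖(avgIter L (mulCfg U' U₀) j z μ : 𝔸) - (avgIter L U₀ j z μ : 𝔸)‖ ≤ α₁) →
      (∀ b ∈ {b : Site d × Fin d | SideTouches ((ι a).Ω 0) b.1 b.2}, ‖((U' b.1 b.2 : 𝔸ˣ) : 𝔸) - 1‖ ≤ α₁) →
      (∀ m, 1 ≤ m → m < (ι a).k → ∀ (u₁ : Site d → 𝔸ˣ) (U₁ : Site d → Fin d → 𝔸ˣ) (A : Site d → Fin d → 𝔸),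
        (∀ x, u₁ x ∈ unitaryUnits 𝔸) → (∀ x, x ∉ (ι a).Ω 0 → u₁ x = 1) → IsPeriodic (p a) u₁ → IsPeriodic (p a) U₁ → IsPeriodic (p a) A →
        mgauge U₀ u₁ U₁ = U' → Restr129 L m ((ι a).Λs m) U₀ u₁ → IsLandau138W L m (ι a).η ((ι a).Ω 0) ((ι a).Λs m) U₀ U₁ →
        (∀ j, j ≤ m → ∀ b ∈ {b : Site d × Fin d | SideTouches ((ι a).Ω j) b.1 b.2},
        U₁ b.1 b.2 = cfgExp (ι a).η A b.1 b.2 ∧ IsSelfAdjoint (A b.1 b.2) ∧ ‖A b.1 b.2‖ ≤ (5 * (d : ℝ) * L * B₈ * (α₀ + α₁)) * ((L : ℝ) ^ j * (ι a).η)⁻¹) →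
        ∃ (v : Site d → 𝔸ˣ) (lam : Site d → 𝔸), (∀ x, v x ∈ unitaryUnits 𝔸) ∧ (∀ x, x ∉ (ι a).Ω 0 → v x = 1) ∧
        (∀ j, j ≤ m + 1 → ∀ b ∈ {b : Site d × Fin d | SideTouches ((ι a).Ω j) b.1 b.2}, (v b.1 : 𝔸) = ((gaugeExp lam b.1 : 𝔸ˣ) : 𝔸) ∧
        (v (b.1 + e b.2) : 𝔸) = ((gaugeExp lam (b.1 + e b.2) : 𝔸ˣ) : 𝔸)) ∧
        (∀ j, j ≤ m + 1 → ∀ b ∈ {b : Site d × Fin d | SideTouches ((ι a).Ω j) b.1 b.2},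
        ‖lam b.1‖ ≤ (8 * B₀' * (5 * (d : ℝ) * L * B₈) * (α₀ + α₁)) ∧ ((L : ℝ) ^ j * (ι a).η) * ‖covDerivFwd (ι a).η U₀ b.2 lam b.1‖ ≤ (8 * B₀' * (5 * (d : ℝ) * L * B₈) * (α₀ + α₁))) ∧
        IsLandau138W L (m + 1) (ι a).η ((ι a).Ω 0) ((ι a).Λs (m + 1)) U₀ (mgauge U₀ v⁻¹ U₁) ∧ Restr129 L (m + 1) ((ι a).Λs (m + 1)) U₀ (u₁ * v) ∧ IsPeriodic (p a) v) := by
  intro a α₀ α₁ hα₀ hα₁ hs U₀ U' hU₀ hU' hU₀p _hU'p φ _hAdm h33 h34 hAx h135 _h66 m hm1 hmk u₁ U₁ A hu₁ _hsupp hu₁p _hU₁p hAp hW h129 hLan hdat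
  obtain ⟨g, Δ, q, qs, Aw, c, H', g_rightΩ, c_range, hGper, hqcq_per, hΔ, hqs, hq, hH0, hH1, hH2, hHsupp, hHequiv, hHper, hQH, hG, hGsupp, hGreal, hRbd, hRreal⟩ :=
    hLet a α₀ hα₀ (by linarith) U₀ hU₀ hU₀p h33 (m + 1) (by omega) hmk
  obtain ⟨hside, hC₂, h61, hsmall₁, hα₀9, hcs9, hα3, hα4, hsmall, hc₃, hsc, hα₃', hs₁, hs₂, hs₃, hs₄, hs₅, hs₆, hs₇, hsm, hprod8, hcA', ha₁', hb₁', hθ, h103, h106⟩ :=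
    hwin α₀ α₁ hα₀ hα₁ hs _ _ _ _ _ _ _ _ rfl rfl rfl rfl rfl rfl rfl rfl
  have hcs0 : 0 ≤ 5 * (d : ℝ) * L * B₈ * (α₀ + α₁) := by
    have : 0 ≤ α₀ + α₁ := by linarith
    positivity
  have hcDAlo : (d : ℝ) * (L : ℝ) ^ 2 * (5 * (d : ℝ) * L * B₈ * (α₀ + α₁)) ≤ 2 * (d : ℝ) * (L : ℝ) ^ 2 * (5 * (d : ℝ) * L * B₈ * (α₀ + α₁)) := by
    have h := mul_nonneg (by positivity : (0 : ℝ) ≤ (d : ℝ) * (L : ℝ) ^ 2) hcs0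
    linarith only [h]
  exact sP5_body_of_join_per hd2 hL (ι a).hη (p a) (ι a).hΩ (ι a).hbox (ι a).hclass hm1 hmk (htw a (m + 1) hmk) (hlt a m hmk) (htop a m hmk)
    hα₀ hα₁ hB₈ hB₀' rfl rfl hU₀ hU' hU₀p h33 h34 hAx h135 hu₁ hu₁p hAp hW h129 hLan hdat (SB9 a m hm1 hmk) hα₀9 hcs9 hside hC₂ h61 hsmall₁
    g Δ q qs Aw c g_rightΩ c_range (fun j hj => hdiv a j (by omega)) (fun j hj => hΛ a (m + 1) hmk j hj) (fun j hj => hΩp a j (by omega))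
    hGper hqcq_per hΔ hqs hq H' hB₀'H hB₂' hBG hBR hH0 hH1 hH2 hHsupp hHequiv hHper hQH hG hGsupp hGreal hRbd hRreal
    le_rfl le_rfl hcDAlo hα3 hα4 hsmall hc₃ hsc hα₃' hs₁ hs₂ hs₃ hs₄ hs₅ hs₆ hs₇ hsm hprod8 rfl rfl rfl rfl hcA' ha₁' hb₁' hθ h103 h106

/-- ★★★ EDITION «L» (letters thresholded at `c_L`, `cP ≤ cL`; `B8Prop5NestedServerPer.sockP5basePer_of_lettersAtPerNested` (p659564) otherwise VERBATIM) of: **pub-ymgap T5's GUARDED SOCKET `SP5base` :117–:130 (PROPOSITION 5, EXISTENCE AT LEVEL `1` FROM `u₁ = 1`, `U₁ = U′`, p. 89; PERIODIC ARGUMENTS,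
NESTED `P`-PERIODIC MEMBERS) — THE BINDER TEXT VERBATIM at instance (i) `LanF := IsLandau138W`**, from the same displayed data as `sockP5PerL_of_lettersAtPerNested`
plus `2 ≤ 5dLB₈` («B₁ not too small», p. 89).  PROOF: letters at `n := 1`, windows, FILE 1's `sP5base_body_of_join_per`.
[cite: Balaban1985RegularSpaces, Prop. 5 (1.107)–(1.108) p.94, p.89, (1.66) p.88, Thm 4 p.88, (1.38) p.82, (1.29) p.81, p.77 («Ω_j ⊂ T_η»); Balaban1985BackgroundPropagators, Thm 3.1 p.397, (3.19) p.393] -/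
theorem sockP5basePerL_of_lettersAtPerNested (hd2 : 2 ≤ d) {L : ℕ} (hL : 2 ≤ L)
    {B₀' B₈ cP cB9 B₀'H B₂' BG BR cL : ℝ}
    (hB₀' : 0 < B₀') (hB₈ : 0 < B₈) (hB₀'H : 0 < B₀'H) (hB₂' : 0 ≤ B₂') (hBG : 0 ≤ BG) (hBR : 0 ≤ BR)
    {J : Type*} (ι : J → ZdIdx d L) (p : J → ℕ) {Φ : Type*}
    (Adm : J → Φ → (Site d → Fin d → 𝔸ˣ) → ℝ → ℝ → Prop)
    -- PER-MEMBER LAWS (displayed): towers «Bʲ(y) ⊂ Ω_j» at every truncation (only truncation `1` is read),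
    -- the torus data `Lʲ ∣ P`, `Λ_j^{(m)}` shift-invariant, `Ω_j` `P`-periodic (print's «Ω_j ⊂ T_η», p. 77)
    (htw : ∀ a : J, ∀ m, m ≤ (ι a).k → ∀ j, j ≤ m → ∀ y ∈ (ι a).Λs m j, ∀ x, InBox (tlo L y j) (thi L y j) x → x ∈ (ι a).Ω j)
    (hdiv : ∀ a : J, ∀ j, j ≤ (ι a).k → ((L : ℤ) ^ j ∣ (p a : ℤ)))
    (hΛ : ∀ a : J, ∀ m, m ≤ (ι a).k → ∀ j, j ≤ m → ∀ (y : Site d) (i : Fin d),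
      y + ((p a : ℤ) / (L : ℤ) ^ j) • e i ∈ (ι a).Λs m j ↔ y ∈ (ι a).Λs m j)
    (hΩp : ∀ a : J, ∀ j, j ≤ (ι a).k → IsPeriodic (p a) (fun x : Site d => x ∈ (ι a).Ω j))
    (hB : 2 ≤ 5 * (d : ℝ) * L * B₈)
    -- THE [4] LETTERS AT NESTED `Ω_j` IN THE SMALL-FIELD CLASS `α₀ ≤ c_L` ([4] Thm 3.1 p. 397; displayed supplier; N06's periodic Green's-function line)
    (hLet : ∀ a : J, ∀ α₀ : ℝ, 0 < α₀ → α₀ ≤ cL → ∀ U₀ : Site d → Fin d → 𝔸ˣ, (∀ x κ, U₀ x κ ∈ unitaryUnits 𝔸) → IsPeriodic (p a) U₀ →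
      InAk L (ι a).k (ι a).η α₀ (ι a).Ω U₀ → ∀ n, 1 ≤ n → n ≤ (ι a).k →
      ∃ (g Δ : (Site d → 𝔸) →ₗ[ℂ] (Site d → 𝔸)) (q : (Site d → 𝔸) →ₗ[ℂ] (ℕ → Site d → 𝔸)) (qs : (ℕ → Site d → 𝔸) →ₗ[ℂ] (Site d → 𝔸))
        (Aw c : (ℕ → Site d → 𝔸) →ₗ[ℂ] (ℕ → Site d → 𝔸)) (H' : XSpace d n 𝔸 →ₗ[ℂ] (Site d → 𝔸)),
        (∀ x, (∀ (z : Site d) (i : Fin d), x (z + (p a : ℤ) • e i) = x z) → ∀ y ∈ (ι a).Ω 0, (Δ (g x) + qs (Aw (q (g x)))) y = x y) ∧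
        (∀ f, (∀ (z : Site d) (i : Fin d), f (z + (p a : ℤ) • e i) = f z) → q (g (g (qs (c (q f))))) = q f) ∧
        (∀ (f : Site d → 𝔸) (z : Site d) (i : Fin d), g f (z + (p a : ℤ) • e i) = g f z) ∧
        (∀ f : Site d → 𝔸, (∀ (z : Site d) (i : Fin d), f (z + (p a : ℤ) • e i) = f z) →
      ∀ (z : Site d) (i : Fin d), qs (c (q f)) (z + (p a : ℤ) • e i) = qs (c (q f)) z) ∧
        (∀ (f : Site d → 𝔸), ∀ x ∈ (ι a).Ω 0, Δ f x = covLap (ι a).η U₀ (((ι a).Ω 0).indicator f) x) ∧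
        (∀ (μ : ℕ → Site d → 𝔸), ∀ x ∈ (ι a).Ω 0, qs μ x = QT L n ((ι a).Λs n) U₀ μ x) ∧
        (∀ (f : Site d → 𝔸) (j : ℕ), j ≤ n → ∀ y ∈ (ι a).Λs n j, q f j y = QprimeIter (zdBlocking d L) (bgT L U₀) j f y) ∧
        (∀ (X : XSpace d n 𝔸) (x : Site d), ‖H' X x‖ ≤ B₀'H * ‖X‖) ∧
        (∀ j, j ≤ n → ∀ (X : XSpace d n 𝔸), ∀ b ∈ {b : Site d × Fin d | SideTouches ((ι a).Ω j) b.1 b.2},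
      wt L (ι a).η j * ‖covDerivFwd (ι a).η U₀ b.2 (H' X) b.1‖ ≤ B₀'H * ‖X‖) ∧
        (∀ X : XSpace d n 𝔸, Bd2 L (ι a).η n (ι a).Ω (covLap (ι a).η U₀ (H' X)) (B₂' * ‖X‖)) ∧
        (∀ (X : XSpace d n 𝔸) (x : Site d), x ∉ (ι a).Ω 0 → H' X x = 0) ∧
        (∀ X Y : XSpace d n 𝔸, (∀ b, Y b = -star (X b)) → ∀ x, H' Y x = -star (H' X x)) ∧
        (∀ X : XSpace d n 𝔸, (∀ (b : Fin (n + 1) × Site d) (i : Fin d), X (b.1, b.2 + ((p a : ℤ) / (L : ℤ) ^ (b.1 : ℕ)) • e i) = X b) →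
      ∀ (z : Site d) (i : Fin d), H' X (z + (p a : ℤ) • e i) = H' X z) ∧
        (∀ (Y : XSpace d n 𝔸), (∀ (b : Fin (n + 1) × Site d) (i : Fin d), Y (b.1, b.2 + ((p a : ℤ) / (L : ℤ) ^ (b.1 : ℕ)) • e i) = Y b) →
      ∀ (j : ℕ) (hj : j ≤ n) (y : Site d), y ∈ (ι a).Λs n j →
      QprimeIter (zdBlocking d L) (bgT L U₀) j (H' Y) y = Y (⟨j, Nat.lt_succ_of_le hj⟩, y)) ∧
        (∀ (f : Site d → 𝔸) (r : ℝ), 0 ≤ r → Bd2 L (ι a).η n (ι a).Ω f r →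
      (∀ x, ‖g f x‖ ≤ BG * r) ∧ ∀ j, j ≤ n → ∀ b ∈ {b : Site d × Fin d | SideTouches ((ι a).Ω j) b.1 b.2},
        wt L (ι a).η j * ‖covDerivFwd (ι a).η U₀ b.2 (g f) b.1‖ ≤ BG * r) ∧
        (∀ (f : Site d → 𝔸) (x : Site d), x ∉ (ι a).Ω 0 → g f x = 0) ∧
        (∀ f : Site d → 𝔸, (∀ j, j ≤ n → ∀ x ∈ (ι a).Ω j, IsSelfAdjoint (f x)) → ∀ x, IsSelfAdjoint (g f x)) ∧
        (∀ (f : Site d → 𝔸) (r : ℝ), 0 ≤ r → Bd2 L (ι a).η n (ι a).Ω f r → Bd2 L (ι a).η n (ι a).Ω (f - g (qs (c (q (g f))))) (BR * r)) ∧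
        (∀ f : Site d → 𝔸, (∀ j, j ≤ n → ∀ x ∈ (ι a).Ω j, IsSelfAdjoint (f x)) →
      ∀ j, j ≤ n → ∀ x ∈ (ι a).Ω j, IsSelfAdjoint ((f - g (qs (c (q (g f))))) x)))
    -- THE JOIN's SCALAR WINDOWS BELOW `cP` (displayed)
    (hwin : ∀ α₀ α₁ : ℝ, 0 < α₀ → 0 < α₁ → α₀ + α₁ ≤ cP → ∀ cs α₄ cB cDA hE hE₂ lE lE₂ : ℝ,
      cs = 5 * (d : ℝ) * L * B₈ * (α₀ + α₁) → α₄ = 8 * B₀' * (5 * (d : ℝ) * L * B₈) * (α₀ + α₁) →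
      cB = L * cs → cDA = 2 * (d : ℝ) * (L : ℝ) ^ 2 * cs →
      hE = B₀'H * (C2p d * (40 * d * cB + α₄) * α₄) → hE₂ = B₂' * (C2p d * (40 * d * cB + α₄) * α₄) →
      lE = B₀'H * (4 * C2p d * (40 * d * cB + 2 * α₄)) → lE₂ = B₂' * (4 * C2p d * (40 * d * cB + 2 * α₄)) →
      36 * d * B₈ * cs ≤ 1 / 2 ∧
      8 * (131072 * ((d : ℝ) + 1) ^ 2) * Real.exp (4 * (800 * ((d : ℝ) + 1) ^ 2 * ((d : ℝ) + 4)) * α₀) ≤ 16 * (131072 * ((d : ℝ) + 1) ^ 2) ∧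
      2 * cs ^ 2 + 20 * d * α₀ * cs + 2 * (16 * (131072 * ((d : ℝ) + 1) ^ 2)) * cs ^ 2 ≤ α₀ + α₁ ∧
      (d : ℝ) * L * α₁ ≤ 1 / 8 ∧
      α₀ ≤ cB9 ∧ cs ≤ cB9 ∧
      C0 d * α₀ ≤ 1 / 3 ∧ 4 * α₀ ≤ c2' d L ∧
      Real.exp (4 * (800 * ((d : ℝ) + 1) ^ 2 * ((d : ℝ) + 4)) * α₀) * (1 + 8 * (131072 * ((d : ℝ) + 1) ^ 2) * cB) ≤ 2 ∧
      2 * cB ≤ c3 d L ∧ 2048 * (d : ℝ) * cB ≤ 1 ∧ 40 * d * cB ≤ 1 / 200 ∧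
      200 * C6 d * (2 * α₄) ≤ 1 ∧ 12000 * ((d : ℝ) + 1) * L * (2 * α₄) ≤ 1 ∧
      C4G d L * (α₀ + 40 * d * cB + 4 * (2 * α₄)) ≤ 1 ∧
      1024 * ((d : ℝ) + 1) * ((d : ℝ) + 4) * L ^ 2 * α₀ ≤ 1 ∧ 32 * ((d : ℝ) + 1) ^ 2 * C6 d * L ^ 2 * α₀ ≤ 1 ∧
      16 * d * C5' d * C6 d * (L : ℝ) ^ 2 * α₀ ≤ 1 ∧ 8 * d * C6 d * L * α₀ ≤ 1 ∧
      40 * d * cB + α₄ ≤ 1 / (4 * B₀'H * (2 * C2p d)) ∧ 2 * C6 d * (40 * d * cB + 4 * α₄) ≤ 1 / 8 ∧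
      cB ≤ 1 / 13 ∧ α₄ / 4 + hE ≤ 1 / 24 ∧ α₄ / 4 + hE ≤ 1 / 140 ∧ 10 * (α₄ / 4 + hE) * BR ≤ 1 / 2 ∧
      BG * Mc d BR (α₄ / 4 + hE) cB hE₂ cDA ≤ α₄ / 4 ∧
      BG * Kc d BR (α₄ / 4 + hE) cB hE₂ cDA lE₂ (1 + lE) (1 + lE) ≤ 1 / 2)
    -- EDITION «L»: the sockets' threshold lies below the letters' small-field threshold
    (hPL : cP ≤ cL) :
    ∀ a : J, ∀ α₀ α₁ : ℝ, 0 < α₀ → 0 < α₁ → α₀ + α₁ ≤ cP →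
      ∀ U₀ U' : Site d → Fin d → 𝔸ˣ, (∀ x κ, U₀ x κ ∈ unitaryUnits 𝔸) → (∀ x κ, U' x κ ∈ unitaryUnits 𝔸) →
      IsPeriodic (p a) U₀ → IsPeriodic (p a) U' → ∀ φ : Φ, Adm a φ U₀ α₀ α₁ →
      InAk L (ι a).k (ι a).η α₀ (ι a).Ω U₀ → InAk L (ι a).k (ι a).η α₀ (ι a).Ω (mulCfg U' U₀) → (∀ m, m ≤ (ι a).k → InAx L m ((ι a).Λs m) U₀ (mulCfg U' U₀)) →
      (∀ j, j ≤ (ι a).k → ∀ (z : Site d) (μ : Fin d),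
        ((∀ x, InBox (tlo L z j) (thi L z j) x → x ∈ (ι a).Ω j) ∨ (∀ x, InBox (tlo L (z + e μ) j) (thi L (z + e μ) j) x → x ∈ (ι a).Ω j)) →
        ‖(avgIter L (mulCfg U' U₀) j z μ : 𝔸) - (avgIter L U₀ j z μ : 𝔸)‖ ≤ α₁) →
      (∀ b ∈ {b : Site d × Fin d | SideTouches ((ι a).Ω 0) b.1 b.2}, ‖((U' b.1 b.2 : 𝔸ˣ) : 𝔸) - 1‖ ≤ α₁) →
      (∃ (v : Site d → 𝔸ˣ) (lam : Site d → 𝔸), (∀ x, v x ∈ unitaryUnits 𝔸) ∧ (∀ x, x ∉ (ι a).Ω 0 → v x = 1) ∧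
        (∀ j, j ≤ 1 → ∀ b ∈ {b : Site d × Fin d | SideTouches ((ι a).Ω j) b.1 b.2}, (v b.1 : 𝔸) = ((gaugeExp lam b.1 : 𝔸ˣ) : 𝔸) ∧
        (v (b.1 + e b.2) : 𝔸) = ((gaugeExp lam (b.1 + e b.2) : 𝔸ˣ) : 𝔸)) ∧
        (∀ j, j ≤ 1 → ∀ b ∈ {b : Site d × Fin d | SideTouches ((ι a).Ω j) b.1 b.2},
        ‖lam b.1‖ ≤ (8 * B₀' * (5 * (d : ℝ) * L * B₈) * (α₀ + α₁)) ∧ ((L : ℝ) ^ j * (ι a).η) * ‖covDerivFwd (ι a).η U₀ b.2 lam b.1‖ ≤ (8 * B₀' * (5 * (d : ℝ) * L * B₈) * (α₀ + α₁))) ∧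
        IsLandau138W L 1 (ι a).η ((ι a).Ω 0) ((ι a).Λs 1) U₀ (mgauge U₀ v⁻¹ U') ∧ Restr129 L 1 ((ι a).Λs 1) U₀ ((1 : Site d → 𝔸ˣ) * v) ∧ IsPeriodic (p a) v) := by
  intro a α₀ α₁ hα₀ hα₁ hs U₀ U' hU₀ hU' hU₀p hU'p φ _hAdm h33 h34 hAx _h135 h66
  obtain ⟨g, Δ, q, qs, Aw, c, H', g_rightΩ, c_range, hGper, hqcq_per, hΔ, hqs, hq, hH0, hH1, hH2, hHsupp, hHequiv, hHper, hQH, hG, hGsupp, hGreal, hRbd, hRreal⟩ :=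
    hLet a α₀ hα₀ (by linarith) U₀ hU₀ hU₀p h33 1 le_rfl (ι a).hk
  obtain ⟨hside, hC₂, h61, hsmall₁, hα₀9, hcs9, hα3, hα4, hsmall, hc₃, hsc, hα₃', hs₁, hs₂, hs₃, hs₄, hs₅, hs₆, hs₇, hsm, hprod8, hcA', ha₁', hb₁', hθ, h103, h106⟩ :=
    hwin α₀ α₁ hα₀ hα₁ hs _ _ _ _ _ _ _ _ rfl rfl rfl rfl rfl rfl rfl rfl
  exact sP5base_body_of_join_per hd2 hL (ι a).hη (p a) (ι a).hk (ι a).hΩ (htw a 1 (ι a).hk) hα₀ hα₁ hB₈ hB₀' hB rfl rfl hU₀ hU' hU₀p hU'p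
    h33 h34 hAx h66 g Δ q qs Aw c g_rightΩ c_range (fun j hj => hdiv a j (hj.trans (ι a).hk)) (fun j hj => hΛ a 1 (ι a).hk j hj)
    (hΩp a 0 (Nat.zero_le _)) hGper hqcq_per hΔ hqs hq H' hB₀'H hB₂' hBG hBR hH0 hH1 hH2 hHsupp hHequiv hHper hQH hG hGsupp hGreal hRbd hRreal
    le_rfl le_rfl le_rfl hα3 hα4 hsmall hc₃ hsc hα₃' hs₁ hs₂ hs₃ hs₄ hs₅ hs₆ hs₇ hsm hprod8 rfl rfl rfl rfl hcA' ha₁' hb₁' hθ h103 h106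

#print axioms sockP5PerL_of_lettersAtPerNested
#print axioms sockP5basePerL_of_lettersAtPerNested

end Sockets

end Literature.MathematicalPhysics.QuantumFieldTheory.Balaban1983to89.B8Prop5NestedServerPerL

end
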